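import Summits.HodgeConjecture.HodgeConjecture.Theorems.F0P2oHeisenbergYCoinvariantsSchur  -- ★ p831043 (this seat): descent ∕ Schur on `S_Y`, `MpPsi` currency
import Literature.RepresentationTheory.HeisenbergGroup.SchrodingerPiOperators              -- ★ `halfForm`, `unipOpPi`, `unipotent_unipOpPi_mem_MpPsi`
import Mathlib.RepresentationTheory.Coinvariants
import HarnessLib

/-!
# Crux `H413`, programme P2, N3 road (S3) at model level — KUDLA'S FILTRATION ON THE `Y`-COINVARIANTS: the `N`-coinvariants of an action on
# `𝒮(F^{ι₁ ⊔ ι₀})` that is TRIVIAL on the fibre over `0` and CONTAINS THE ANISOTROPIC CHIRPS are the fibre over `0`, `r_N ≅ 𝒮(F^{ι₀})`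

Cell hodgecm-mathlib (D-0151), FLOOR 0, crux item H413 = stmt-HodgeConjecture-24833, programme P2; N3 road (`F0/P2/B-p18/g28/N3-ROAD.v1.B-p18g28.md`,
K1 lead B-p18 (g28)) §2 steps **(S2)** «`N(ℓ)` acts on `S_Y` by scalars» and **(S3)** «KEY (Kudla's anisotropy argument): the centre `Z(N(ℓ)) ≅ F` acts
through characters `y* ↦ ψ(z·Q(y*))` with `Q` the ANISOTROPIC norm form … `r_{N(ℓ)}(ω) = S_Y` (`N(ℓ)` acts trivially on `S_Y`)», isolated as
MODEL-LEVEL facts in the `Y`-adapted dot model of ★ p830834 ∕ ★ p831043 (`S = 𝒮(F^{ι₁ ⊔ ι₀})`, `Y = 0 × (F^{ι₁} × 0)`, `X₀ = {x | x|ι₁ = 0}`,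
`S_Y` computed by the fibre-over-`0` map `φ₀ : S → 𝒮(F^{ι₀})`).  Seat A-p12 (g17), self-dealt sequel of ROW «N3-S1» (census 18:37Z).  THEOREMS
ONLY (no `def`, no instance, no notation, no named fact, no `sorry`); never imports a `Cruxes/…/Lines` module; kernel lane
`--supports stmt-HodgeConjecture-24833 --as helper`.  HC_CM is proved only modulo the printed citations until rung 0 closes; nothing printed is
asserted here.

THE CURRENCY OF THE N3 LETTER (★ `GelbartRogawski1991.thetaType_nonsplit_jacquetModule` (a)): `r_N(X_v)` is Mathlib's `Representation.Coinvariants`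
of the restriction to `N` (★ `ParabolicTriple.restrict`), `Coinvariants.ker τ = span {τ n x − x}`.  So the model-level head is stated for an ARBITRARY
representation `τ` of an arbitrary group `N` on `S`:

* §1 CHIRPS DIE ON THE FIBRE: for a second-degree datum `c` whose chirp `ψ(−½⟨x, c x⟩)` is `1` on `X₀` (`hc0`), `φ₀ ∘ unipOpPi c = φ₀`
  (`fibreZero_unipOpPi`); `halfForm (t • c) = t · halfForm c`.
* §2 KUDLA: if `c` is ANISOTROPIC TRANSVERSALLY TO `X₀` (`hca : halfForm c x = 0 → x|ι₁ = 0`), every `f` with `φ₀ f = 0` is a finite sum of chirp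
  coboundaries `unipOpPi (t • c) φ − φ` (`mem_span_unipOpPi_sub_of_fibreZero_eq_zero`) — ★ p829212 `mem_span_mul_sub_of_forall_eq_zero` at `X₀` with the
  multipliers `x ↦ ψ(−t·½⟨x, c x⟩)` (locally constant; `= 1` on `X₀`; they SEPARATE every point off `X₀` because `c` is anisotropic there and `ψ ≠ 1`) —
  hence **`ker φ₀ = span {unipOpPi (t • c) φ − φ}`** (`ker_fibreZero_eq_span_unipOpPi`, with `hc0`).
* §3 THE HEAD: for `τ : Representation ℂ N S` with **(h₁)** `φ₀ (τ n f) = φ₀ f` (`N` acts trivially on `S_Y`) and **(h₂)** every anisotropic chirp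
  `unipOpPi (t • c)` is some `τ n`: **`Coinvariants.ker τ = ker φ₀`** (`coinvariantsKer_eq_ker_fibreZero`), **`τ.Coinvariants ≃ₗ[ℂ] 𝒮(F^{ι₀})` through
  `φ₀`** (`exists_coinvariants_equiv_fibre`; ★ `fibreZero_surjective`), and the factored map `Coinvariants.lift τ φ₀` is a bijection
  (`lift_fibreZero_bijective`) — B-p18's «`r_{N(ℓ)}(ω) = S_Y`».
* §4 DISCHARGING (h₁) — scalar bookkeeping in the `MpPsi` currency of ★ p831043 (where every `p ∈ S̃p_ψ` trivial on `Y^⊥ ∕ Y` acts on `S_Y` by a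
  non-zero scalar `c_p`, ★ `exists_fibreZero_toRep_eq_smul`): `c_{p⁻¹} = c_p⁻¹` (`fibreZero_toRep_inv_eq_smul`), COMMUTATORS act trivially
  (`fibreZero_toRep_commutator`), conjugating by a `q` with `q Y ⊆ Y` does not change the scalar (`fibreZero_toRep_conj_eq_smul`, by the descent
  ★ `exists_descent_of_implements` — Weil's correction `f_q` vanishes on `Y`), so CONJUGATION-QUOTIENTS `q p q⁻¹ p⁻¹` act trivially
  (`fibreZero_toRep_conj_mul_inv`).  In U(2,1), `N(ℓ)` is generated by `m(α) n m(α)⁻¹ n⁻¹` (`m(α) n(b, z) m(α)⁻¹ = n(αb, Nα·z)`) and commutators, so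
  `N(ℓ)` acts TRIVIALLY on `S_Y` — no splitting input.
* §5 DISCHARGING (h₂) SCALAR-FREE: an implementer of the Siegel unipotent `n(c)` that is trivial on `S_Y` IS `unipOpPi c` on the nose
  (`toRep_eq_unipOpPi_of_fibreZero`: ★ `implementerUniqueUpToScalar_schrodingerSB_pi` + §1 + `φ₀` onto a non-zero space) — so the centre
  `Z(N(ℓ)) = {n_t}` (Siegel unipotents with the anisotropic norm form on the line's coordinates, ★ `frameCoords_lineRoot_zero`) lands in (h₂).

NOT here (→ the (S2)-b docking file): the frame chart `Γ` (★ `IsQuadraticCoordinates.exists_frameChart`), the model transport `Ψ`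
(★ `SchrodingerSymplecticTransport.exists_intertwiner_of_symplectic`), the U(V)-side group law of `P(ℓ)`.

## References
* [Kudla1986] S. Kudla, *On the local theta-correspondence*, Invent. Math. 83 (1986) 229–255: Thm. 2.8 and its proof (the filtration; anisotropic case).
* [MoeglinVignerasWaldspurger1987] *Correspondances de Howe sur un corps p-adique*, LNM 1291 (1987): Chap. 2 II.1 (A), II.6; Chap. 3 §IV.5 (filtration de Kudla).
* [GelbartRogawski1991] Invent. Math. 105 (1991): §3.2 (3.2.3) p. 457 (`ω_ψ[(c,t)]Φ(w) = ψ(t N(w)) ρ_ψ¹([cw,0]) Φ(w)`).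
* [BernsteinZelevinsky1976] Russian Math. Surveys 31 (1976): §2.30–2.33.  [Rangarao1993] Pacific J. Math. 157 (1993): Lemma 3.2.  [Weil1964] Acta Math. 111: n° 5–6.
-/

set_option autoImplicit false
set_option linter.dupNamespace false -- the mandated namespace repeats the single-problem summit's segment

noncomputable section

open Set
open Literature.NumberTheory.Automorphic Literature.RepresentationTheory Literature.RepresentationTheory.HeisenbergGroup
open Summit.HodgeConjecture.HodgeConjecture.Cruxes.H413.F0P2oLocallyConstantCoboundary
open Summit.HodgeConjecture.HodgeConjecture.Cruxes.H413.F0P2oHeisenbergYCoinvariants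
open Summit.HodgeConjecture.HodgeConjecture.Cruxes.H413.F0P2oHeisenbergYCoinvariantsSchur

namespace Summit.HodgeConjecture.HodgeConjecture.Cruxes.H413.F0P2oHeisenbergYCoinvariantsJacquet

variable {F : Type*} [Field F] [ValuativeRel F] [TopologicalSpace F] [IsNonarchimedeanLocalField F]
  {ι₁ ι₀ : Type*} [Fintype ι₁] [Fintype ι₀]
  {ψ : AddChar F Circle} (hl : IsLocallyConstant (⇑ψ : F → Circle))
  (hb : ∀ y : ι₁ ⊕ ι₀ → F, Continuous fun u : ι₁ ⊕ ι₀ → F => dotProductBilin F F u y)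
  (hb₀ : ∀ y₀ : ι₀ → F, Continuous fun u₀ : ι₀ → F => dotProductBilin F F u₀ y₀)
  (φ₀ : SchwartzBruhat (ι₁ ⊕ ι₀ → F) →ₗ[ℂ] SchwartzBruhat (ι₀ → F))
  (hφ₀ : ∀ (f : SchwartzBruhat (ι₁ ⊕ ι₀ → F)) (u₀ : ι₀ → F),
    (φ₀ f : (ι₀ → F) → ℂ) u₀ = (f : (ι₁ ⊕ ι₀ → F) → ℂ) (Sum.elim 0 u₀))

/-! ## §1 Chirps that are `1` on `X₀ = {x | x|ι₁ = 0}` die on the fibre over `0` -/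

section Chirp

variable [Invertible (2 : F)] (c : (ι₁ ⊕ ι₀ → F) →ₗ[F] (ι₁ ⊕ ι₀ → F))

omit [ValuativeRel F] [TopologicalSpace F] [IsNonarchimedeanLocalField F] in
/-- `½⟨x, (t c) x⟩ = t · ½⟨x, c x⟩` — the chirps of the line `t ↦ n(t c)` of Siegel unipotents. [cite: Rangarao1993, Lemma 3.1, p. 351] -/
theorem halfForm_smul (t : F) (x : ι₁ ⊕ ι₀ → F) : halfForm (t • c) x = t * halfForm c x := by
  rw [halfForm_apply, halfForm_apply, LinearMap.smul_apply, dotProduct_smul, smul_eq_mul]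
  ring

include hφ₀ in
/-- **a chirp that is `1` on `X₀` dies on the fibre over `0`**: if `½⟨x, c x⟩ = 0` whenever `x|ι₁ = 0` then `φ₀ (unipOpPi c f) = φ₀ f` — the Siegel
unipotents `n(c)` with `c` supported on the `Y`-block act TRIVIALLY on `S_Y` (not merely by a scalar).
[cite: Kudla1986, proof of Thm. 2.8] [cite: MoeglinVignerasWaldspurger1987, Chap. 3 §IV.5] [cite: Rangarao1993, Lemma 3.2 (1), p. 351] -/
theorem fibreZero_unipOpPi (hc0 : ∀ x : ι₁ ⊕ ι₀ → F, x ∘ Sum.inl = 0 → halfForm c x = 0) (f : SchwartzBruhat (ι₁ ⊕ ι₀ → F)) :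
    φ₀ (unipOpPi hl c f) = φ₀ f := by
  apply Subtype.ext
  funext u₀
  rw [hφ₀, hφ₀, coe_unipOpPi_apply, hc0 _ (Sum.elim_comp_inl (0 : ι₁ → F) u₀), neg_zero, AddChar.map_zero_eq_one, Circle.coe_one, one_mul]

include hφ₀ in
/-- the chirp coboundaries `unipOpPi (t c) φ − φ` lie in `ker φ₀`. [cite: Kudla1986, proof of Thm. 2.8] [cite: MoeglinVignerasWaldspurger1987, Chap. 3 §IV.5] -/
theorem span_unipOpPi_sub_le_ker_fibreZero (hc0 : ∀ x : ι₁ ⊕ ι₀ → F, x ∘ Sum.inl = 0 → halfForm c x = 0) :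
    Submodule.span ℂ (Set.range fun p : F × SchwartzBruhat (ι₁ ⊕ ι₀ → F) => unipOpPi hl (p.1 • c) p.2 - p.2) ≤ LinearMap.ker φ₀ := by
  refine Submodule.span_le.2 ?_
  rintro _ ⟨⟨t, f⟩, rfl⟩
  rw [SetLike.mem_coe, LinearMap.mem_ker, map_sub, fibreZero_unipOpPi hl φ₀ hφ₀ (t • c) ?_ f, sub_self]
  intro x hx
  rw [halfForm_smul, hc0 x hx, mul_zero]

/-! ## §2 Kudla's anisotropy argument: `ker φ₀` is spanned by the chirp coboundaries -/

include hφ₀ in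
/-- **KUDLA'S COBOUNDARY DIRECTION**: if `c` is ANISOTROPIC TRANSVERSALLY TO `X₀` (`½⟨x, c x⟩ = 0 ⇒ x|ι₁ = 0`) and `ψ` is continuous and
non-trivial, every `f ∈ 𝒮(F^{ι₁ ⊔ ι₀})` with `φ₀ f = 0` is a finite sum of chirp coboundaries `unipOpPi (t c) φ − φ` (`t ∈ F`).  Proof: ★ p829212
`mem_span_mul_sub_of_forall_eq_zero` at `X₀` with the multipliers `x ↦ ψ(−t·½⟨x, c x⟩)` — locally constant (★ `continuous_halfForm`), and a point `x ∉ X₀`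
has `q := ½⟨x, c x⟩ ≠ 0`, so `t := −z∕q` with `ψ z ≠ 1` moves it. [cite: Kudla1986, proof of Thm. 2.8] [cite: MoeglinVignerasWaldspurger1987, Chap. 3 §IV.5]
[cite: GelbartRogawski1991, §3.2 (3.2.3) p. 457] [cite: BernsteinZelevinsky1976, §2.30–2.33] -/
theorem mem_span_unipOpPi_sub_of_fibreZero_eq_zero (hψ : ψ.IsContinuousNontrivial)
    (hca : ∀ x : ι₁ ⊕ ι₀ → F, halfForm c x = 0 → x ∘ Sum.inl = 0)
    {f : SchwartzBruhat (ι₁ ⊕ ι₀ → F)} (hf : φ₀ f = 0) :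
    f ∈ Submodule.span ℂ (Set.range fun p : F × SchwartzBruhat (ι₁ ⊕ ι₀ → F) => unipOpPi hl (p.1 • c) p.2 - p.2) := by
  classical
  -- the multipliers `x ↦ ψ(-½⟨x, (t c) x⟩)`, locally constant, moving every point off `X₀ = {x | x|ι₁ = 0}`
  set 𝒰 : Set ((ι₁ ⊕ ι₀ → F) → ℂ) := Set.range fun t : F => fun u => ((ψ (-halfForm (t • c) u) : Circle) : ℂ) with h𝒰
  have h𝒰lc : ∀ u ∈ 𝒰, IsLocallyConstant u := by
    rintro _ ⟨t, rfl⟩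
    exact (hl.comp_continuous (continuous_halfForm (t • c)).neg).comp Subtype.val
  have hsep : ∀ u : ι₁ ⊕ ι₀ → F, u ∉ {u | u ∘ Sum.inl = 0} → ∃ m ∈ 𝒰, m u ≠ 1 := by
    intro u hu
    have hq : halfForm c u ≠ 0 := fun h => hu (hca u h)
    obtain ⟨z, hz⟩ : ∃ z : F, ψ z ≠ 1 := AddChar.ne_zero_iff.1 hψ.2
    refine ⟨_, ⟨-(z / halfForm c u), rfl⟩, fun h => hz ?_⟩
    have ht : -halfForm ((-(z / halfForm c u)) • c) u = z := by
      rw [halfForm_smul, neg_mul, neg_neg, div_mul_cancel₀ z hq]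
    rw [← ht]
    exact Circle.coe_inj.1 (by rw [Circle.coe_one]; exact h)
  have hf₀ : ∀ u ∈ {u : ι₁ ⊕ ι₀ → F | u ∘ Sum.inl = 0}, (f : (ι₁ ⊕ ι₀ → F) → ℂ) u = 0 := by
    intro u hu
    rw [eq_sumElim_zero_of_comp_inl_eq_zero hu, ← hφ₀, hf]
    rfl
  have hmem := mem_span_mul_sub_of_forall_eq_zero 𝒰 h𝒰lc {u | u ∘ Sum.inl = 0} hsep f.2 hf₀
  -- the ambient span is the image of ours under the inclusion `𝒮 ↪ (X → ℂ)`
  have hle : Submodule.span ℂ {g : (ι₁ ⊕ ι₀ → F) → ℂ | ∃ u' ∈ 𝒰, ∃ φ ∈ SchwartzBruhat (ι₁ ⊕ ι₀ → F), g = u' * φ - φ} ≤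
      (Submodule.span ℂ (Set.range fun p : F × SchwartzBruhat (ι₁ ⊕ ι₀ → F) => unipOpPi hl (p.1 • c) p.2 - p.2)).map
        (SchwartzBruhat (ι₁ ⊕ ι₀ → F)).subtype := by
    refine Submodule.span_le.2 ?_
    rintro _ ⟨_, ⟨t, rfl⟩, φ, hφ, rfl⟩
    refine ⟨unipOpPi hl (t • c) ⟨φ, hφ⟩ - ⟨φ, hφ⟩, Submodule.subset_span ⟨(t, ⟨φ, hφ⟩), rfl⟩, ?_⟩
    rw [map_sub, Submodule.subtype_apply, Submodule.subtype_apply]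
    congr 1
  obtain ⟨g, hg, hgf⟩ := hle hmem
  have : g = f := Subtype.ext hgf
  rw [← this]
  exact hg

include hφ₀ in
/-- **KUDLA'S FILTRATION IN THE MODEL: `ker φ₀ = span {unipOpPi (t c) φ − φ : t ∈ F, φ}`** for a second-degree datum `c` whose chirp is `1` on `X₀`
and anisotropic transversally to `X₀` — «the fibres at `w ≠ 0` carry non-trivial characters of the centre and die; at `w = 0` the centre acts
trivially». [cite: Kudla1986, Thm. 2.8 and its proof] [cite: MoeglinVignerasWaldspurger1987, Chap. 3 §IV.5] [cite: GelbartRogawski1991, §3.2 (3.2.3) p. 457] -/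
theorem ker_fibreZero_eq_span_unipOpPi (hψ : ψ.IsContinuousNontrivial)
    (hc0 : ∀ x : ι₁ ⊕ ι₀ → F, x ∘ Sum.inl = 0 → halfForm c x = 0) (hca : ∀ x : ι₁ ⊕ ι₀ → F, halfForm c x = 0 → x ∘ Sum.inl = 0) :
    LinearMap.ker φ₀ = Submodule.span ℂ (Set.range fun p : F × SchwartzBruhat (ι₁ ⊕ ι₀ → F) => unipOpPi hl (p.1 • c) p.2 - p.2) :=
  le_antisymm (fun _ hf => mem_span_unipOpPi_sub_of_fibreZero_eq_zero hl φ₀ hφ₀ c hψ hca (LinearMap.mem_ker.1 hf))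
    (span_unipOpPi_sub_le_ker_fibreZero hl φ₀ hφ₀ c hc0)

end Chirp

/-! ## §3 The head: `N`-coinvariants of an action trivial on `S_Y` and containing the anisotropic chirps -/

section Coinvariants

variable {N : Type*} [Group N] (τ : Representation ℂ N (SchwartzBruhat (ι₁ ⊕ ι₀ → F)))

omit [Field F] [ValuativeRel F] [IsNonarchimedeanLocalField F] [Fintype ι₁] [Fintype ι₀] in
/-- **(⊆)** if `N` acts trivially on `S_Y` (`φ₀ ∘ τ n = φ₀`), the `N`-coboundaries lie in `ker φ₀`. [cite: BernsteinZelevinsky1976, §2.30–2.33] -/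
theorem coinvariantsKer_le_ker_fibreZero (h₁ : ∀ (n : N) (f : SchwartzBruhat (ι₁ ⊕ ι₀ → F)), φ₀ (τ n f) = φ₀ f) :
    Representation.Coinvariants.ker τ ≤ LinearMap.ker φ₀ := by
  refine Submodule.span_le.2 ?_
  rintro _ ⟨⟨n, f⟩, rfl⟩
  rw [SetLike.mem_coe, LinearMap.mem_ker, map_sub, h₁, sub_self]

variable [Invertible (2 : F)] (c : (ι₁ ⊕ ι₀ → F) →ₗ[F] (ι₁ ⊕ ι₀ → F))

include hφ₀ in
/-- **(⊇)** if every anisotropic chirp `unipOpPi (t c)` is some `τ n`, then `ker φ₀` consists of `N`-coboundaries (§2).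
[cite: Kudla1986, proof of Thm. 2.8] [cite: MoeglinVignerasWaldspurger1987, Chap. 3 §IV.5] -/
theorem ker_fibreZero_le_coinvariantsKer (hψ : ψ.IsContinuousNontrivial) (hca : ∀ x : ι₁ ⊕ ι₀ → F, halfForm c x = 0 → x ∘ Sum.inl = 0)
    (h₂ : ∀ t : F, ∃ n : N, ∀ f : SchwartzBruhat (ι₁ ⊕ ι₀ → F), τ n f = unipOpPi hl (t • c) f) :
    LinearMap.ker φ₀ ≤ Representation.Coinvariants.ker τ := by
  intro f hf
  have hmem := mem_span_unipOpPi_sub_of_fibreZero_eq_zero hl φ₀ hφ₀ c hψ hca (LinearMap.mem_ker.1 hf)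
  refine Submodule.span_le.2 ?_ hmem
  rintro _ ⟨⟨t, g⟩, rfl⟩
  obtain ⟨n, hn⟩ := h₂ t
  show unipOpPi hl (t • c) g - g ∈ Representation.Coinvariants.ker τ
  rw [← hn g]
  exact Representation.Coinvariants.sub_mem_ker n g

include hφ₀ in
/-- **THE HEAD — `Coinvariants.ker τ = ker φ₀`**: for a representation `τ` of any group `N` on `𝒮(F^{ι₁ ⊔ ι₀})` that is TRIVIAL on `S_Y` (h₁) and
CONTAINS THE ANISOTROPIC CHIRPS `unipOpPi (t c)` (h₂), the `N`-coboundaries are exactly the kernel of the fibre over `0`.  (N3 road: `N = N(ℓ)`,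
`τ =` the transported Weil action, (h₁) by §4, (h₂) by §5 on the centre `Z(N(ℓ))`.) [cite: Kudla1986, Thm. 2.8] [cite: MoeglinVignerasWaldspurger1987, Chap. 3 §IV.5]
[cite: GelbartRogawski1991, §3.2 (3.2.3) p. 457] -/
theorem coinvariantsKer_eq_ker_fibreZero (hψ : ψ.IsContinuousNontrivial) (hca : ∀ x : ι₁ ⊕ ι₀ → F, halfForm c x = 0 → x ∘ Sum.inl = 0)
    (h₁ : ∀ (n : N) (f : SchwartzBruhat (ι₁ ⊕ ι₀ → F)), φ₀ (τ n f) = φ₀ f)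
    (h₂ : ∀ t : F, ∃ n : N, ∀ f : SchwartzBruhat (ι₁ ⊕ ι₀ → F), τ n f = unipOpPi hl (t • c) f) :
    Representation.Coinvariants.ker τ = LinearMap.ker φ₀ :=
  le_antisymm (coinvariantsKer_le_ker_fibreZero φ₀ τ h₁) (ker_fibreZero_le_coinvariantsKer hl φ₀ hφ₀ τ c hψ hca h₂)

include hφ₀ in
/-- **`r_N ≅ 𝒮(F^{ι₀})` THROUGH `φ₀`**: under (h₁), (h₂) the `N`-coinvariants `τ.Coinvariants` are identified with `𝒮(F^{ι₀})` by a linear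
isomorphism `e` with `e [f] = φ₀ f` (`φ₀` is onto, ★ `fibreZero_surjective`) — B-p18's «`r_{N(ℓ)}(ω) = S_Y`».
[cite: Kudla1986, Thm. 2.8] [cite: MoeglinVignerasWaldspurger1987, Chap. 3 §IV.5] [cite: BernsteinZelevinsky1976, §2.30–2.33] -/
theorem exists_coinvariants_equiv_fibre (hψ : ψ.IsContinuousNontrivial) (hca : ∀ x : ι₁ ⊕ ι₀ → F, halfForm c x = 0 → x ∘ Sum.inl = 0)
    (h₁ : ∀ (n : N) (f : SchwartzBruhat (ι₁ ⊕ ι₀ → F)), φ₀ (τ n f) = φ₀ f)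
    (h₂ : ∀ t : F, ∃ n : N, ∀ f : SchwartzBruhat (ι₁ ⊕ ι₀ → F), τ n f = unipOpPi hl (t • c) f) :
    ∃ e : τ.Coinvariants ≃ₗ[ℂ] SchwartzBruhat (ι₀ → F), ∀ f, e (Representation.Coinvariants.mk τ f) = φ₀ f :=
  ⟨(Submodule.quotEquivOfEq _ _ (coinvariantsKer_eq_ker_fibreZero hl φ₀ hφ₀ τ c hψ hca h₁ h₂)).trans
      (φ₀.quotKerEquivOfSurjective (fibreZero_surjective φ₀ hφ₀)), fun _ => rfl⟩

include hφ₀ in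
/-- **the factored map `Coinvariants.lift τ φ₀ : r_N → 𝒮(F^{ι₀})` is a BIJECTION** under (h₁), (h₂) (Mathlib `Coinvariants.lift_mk`: `lift [f] = φ₀ f`;
so any operator on `S` normalising `τ(N)` and carried by `φ₀` to an operator `L₀` on `𝒮(F^{ι₀})` acts on `r_N` as `L₀` — the torus ∕ `U(V₁) × U(W)`
bookkeeping of (S4) reads through this map, ★ `Representation.jacquetModule_mk`). [cite: BernsteinZelevinsky1976, §2.30–2.33] [cite: Kudla1986, Thm. 2.8] -/
theorem lift_fibreZero_bijective (hψ : ψ.IsContinuousNontrivial) (hca : ∀ x : ι₁ ⊕ ι₀ → F, halfForm c x = 0 → x ∘ Sum.inl = 0)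
    (h₁ : ∀ (n : N) (f : SchwartzBruhat (ι₁ ⊕ ι₀ → F)), φ₀ (τ n f) = φ₀ f)
    (h₂ : ∀ t : F, ∃ n : N, ∀ f : SchwartzBruhat (ι₁ ⊕ ι₀ → F), τ n f = unipOpPi hl (t • c) f) :
    Function.Bijective (Representation.Coinvariants.lift τ φ₀ fun n => LinearMap.ext (h₁ n)) := by
  refine ⟨?_, ?_⟩
  · intro x y hxy
    obtain ⟨f, rfl⟩ := Representation.Coinvariants.mk_surjective τ x
    obtain ⟨g, rfl⟩ := Representation.Coinvariants.mk_surjective τ y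
    rw [Representation.Coinvariants.lift_mk, Representation.Coinvariants.lift_mk] at hxy
    rw [Representation.Coinvariants.mk_eq_iff, coinvariantsKer_eq_ker_fibreZero hl φ₀ hφ₀ τ c hψ hca h₁ h₂, LinearMap.mem_ker, map_sub, hxy,
      sub_self]
  · intro g
    obtain ⟨f, rfl⟩ := fibreZero_surjective φ₀ hφ₀ g
    exact ⟨Representation.Coinvariants.mk τ f, Representation.Coinvariants.lift_mk τ φ₀ _ f⟩

end Coinvariants

/-! ## §4 Discharging (h₁): inverses, commutators and conjugation-quotients act trivially on `S_Y` -/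

section Scalars

variable [Invertible (2 : F)]

/-- **`c_{p⁻¹} = c_p⁻¹`**: if `p ∈ S̃p_ψ` acts on `S_Y` (through `φ₀`) by the non-zero scalar `c`, then `p⁻¹` acts by `c⁻¹`.
[cite: MoeglinVignerasWaldspurger1987, Chap. 2 II.1 (A); Chap. 3 §IV.5] -/
theorem fibreZero_toRep_inv_eq_smul (p : MpPsi (schrodingerSB (dotProductBilin F F (m := ι₁ ⊕ ι₀)) ψ hl hb)) {c : ℂ} (hc : c ≠ 0)
    (hcp : ∀ f : SchwartzBruhat (ι₁ ⊕ ι₀ → F), φ₀ (MpPsi.toRep (schrodingerSB (dotProductBilin F F) ψ hl hb) p f) = c • φ₀ f)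
    (f : SchwartzBruhat (ι₁ ⊕ ι₀ → F)) :
    φ₀ (MpPsi.toRep (schrodingerSB (dotProductBilin F F) ψ hl hb) p⁻¹ f) = c⁻¹ • φ₀ f := by
  have h := hcp (MpPsi.toRep (schrodingerSB (dotProductBilin F F) ψ hl hb) p⁻¹ f)
  rw [← Module.End.mul_apply, ← map_mul, mul_inv_cancel, map_one, Module.End.one_apply] at h
  rw [h, smul_smul, inv_mul_cancel₀ hc, one_smul]

/-- **COMMUTATORS ACT TRIVIALLY ON `S_Y`**: if `p`, `q ∈ S̃p_ψ` act on `S_Y` by non-zero scalars `c_p`, `c_q`, then `p q p⁻¹ q⁻¹` acts by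
`c_p c_q c_p⁻¹ c_q⁻¹ = 1` — the scalars form a character, trivial on commutators (N3 road: the centre `Z(N(ℓ)) = [N(ℓ), N(ℓ)]`).
[cite: MoeglinVignerasWaldspurger1987, Chap. 2 II.1 (A); Chap. 3 §IV.5] [cite: Kudla1986, proof of Thm. 2.8] -/
theorem fibreZero_toRep_commutator (p q : MpPsi (schrodingerSB (dotProductBilin F F (m := ι₁ ⊕ ι₀)) ψ hl hb)) {cp cq : ℂ}
    (hcp0 : cp ≠ 0) (hcq0 : cq ≠ 0)
    (hcp : ∀ f : SchwartzBruhat (ι₁ ⊕ ι₀ → F), φ₀ (MpPsi.toRep (schrodingerSB (dotProductBilin F F) ψ hl hb) p f) = cp • φ₀ f)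
    (hcq : ∀ f : SchwartzBruhat (ι₁ ⊕ ι₀ → F), φ₀ (MpPsi.toRep (schrodingerSB (dotProductBilin F F) ψ hl hb) q f) = cq • φ₀ f)
    (f : SchwartzBruhat (ι₁ ⊕ ι₀ → F)) :
    φ₀ (MpPsi.toRep (schrodingerSB (dotProductBilin F F) ψ hl hb) (p * q * p⁻¹ * q⁻¹) f) = φ₀ f := by
  rw [map_mul, map_mul, map_mul, Module.End.mul_apply, Module.End.mul_apply, Module.End.mul_apply, hcp, hcq,
    fibreZero_toRep_inv_eq_smul hl hb φ₀ p hcp0 hcp, fibreZero_toRep_inv_eq_smul hl hb φ₀ q hcq0 hcq, smul_smul, smul_smul, smul_smul]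
  have h1 : cp * cq * cp⁻¹ * cq⁻¹ = 1 := by
    field_simp
  rw [h1, one_smul]

omit [ValuativeRel F] [TopologicalSpace F] [IsNonarchimedeanLocalField F] in
/-- Weil's section on a `g ∈ Sp` with `g Y ⊆ Y` has NO central correction on `Y`: `(g, f_g) · ((0, (y₁, 0)), 0) = ((0, (y₁', 0)), 0)` (`f_g(w) =
½(⟨gw|gw⟩ − ⟨w|w⟩)` vanishes because both `w` and `g w` lie in `0 × F^{ι₁ ⊔ ι₀}`). [cite: Weil1964, n° 5, pp. 150–151] -/
theorem exists_act_ofSymplectic_eq_of_mapsTo (g : symplecticGroup (polar (dotProductBilin F F (m := ι₁ ⊕ ι₀))))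
    (hg : ∀ y₁ : ι₁ → F, ∃ y₁' : ι₁ → F, g.1 (0, Sum.elim y₁ 0) = (0, Sum.elim y₁' 0)) (y₁ : ι₁ → F) :
    ∃ y₁' : ι₁ → F, (ofSymplectic (polar (dotProductBilin F F (m := ι₁ ⊕ ι₀))) g).act
      (⟨(0, Sum.elim y₁ 0), 0⟩ : Heisenberg (polar (dotProductBilin F F (m := ι₁ ⊕ ι₀)))) = ⟨(0, Sum.elim y₁' 0), 0⟩ := by
  obtain ⟨y₁', hy⟩ := hg y₁
  refine ⟨y₁', ?_⟩
  change (⟨g.1 (0, Sum.elim y₁ 0), 0 + (ofSymplectic (polar (dotProductBilin F F (m := ι₁ ⊕ ι₀))) g).f (0, Sum.elim y₁ 0)⟩ :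
      Heisenberg (polar (dotProductBilin F F (m := ι₁ ⊕ ι₀)))) = ⟨(0, Sum.elim y₁' 0), 0⟩
  simp only [ofSymplectic_f, hy, polar_apply, dotProductBilin_apply_apply, zero_dotProduct, sub_self, mul_zero, add_zero]

include hφ₀ in
/-- **CONJUGATION BY A `Y`-STABLE `q` DOES NOT CHANGE THE SCALAR**: if `q ∈ S̃p_ψ` maps `Y` into `Y` (so `q` descends to `S_Y`, ★
`exists_descent_of_implements`) and `p` acts on `S_Y` by the scalar `c`, then `q p q⁻¹` acts by `c` — the character of §4 is invariant under the
parabolic `P_Y` (N3 road: under `P(ℓ) × U(W)`, in particular under the torus `m(α)`).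
[cite: MoeglinVignerasWaldspurger1987, Chap. 2 II.1 (A); Chap. 3 §IV.2, §IV.5] [cite: BernsteinZelevinsky1976, §2.30–2.33] -/
theorem fibreZero_toRep_conj_eq_smul (hψ : ψ.IsContinuousNontrivial) (q : MpPsi (schrodingerSB (dotProductBilin F F (m := ι₁ ⊕ ι₀)) ψ hl hb))
    (hq : ∀ y₁ : ι₁ → F, ∃ y₁' : ι₁ → F, (q.1.1).1 (0, Sum.elim y₁ 0) = (0, Sum.elim y₁' 0))
    (p : MpPsi (schrodingerSB (dotProductBilin F F (m := ι₁ ⊕ ι₀)) ψ hl hb)) {c : ℂ}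
    (hcp : ∀ f : SchwartzBruhat (ι₁ ⊕ ι₀ → F), φ₀ (MpPsi.toRep (schrodingerSB (dotProductBilin F F) ψ hl hb) p f) = c • φ₀ f)
    (f : SchwartzBruhat (ι₁ ⊕ ι₀ → F)) :
    φ₀ (MpPsi.toRep (schrodingerSB (dotProductBilin F F) ψ hl hb) (q * p * q⁻¹) f) = c • φ₀ f := by
  obtain ⟨M₀, hM₀⟩ := exists_descent_of_implements hl hb φ₀ hφ₀ (ofSymplectic _ q.1.1) q.1.2 ((mem_MpPsi _ _).1 q.2)
    (exists_act_ofSymplectic_eq_of_mapsTo q.1.1 hq) hψ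
  have hM₀' : ∀ g : SchwartzBruhat (ι₁ ⊕ ι₀ → F),
      φ₀ (MpPsi.toRep (schrodingerSB (dotProductBilin F F) ψ hl hb) q g) = M₀ (φ₀ g) := fun g => by
    rw [MpPsi.toRep_apply]
    exact (hM₀ g).symm
  have hinv : ∀ g : SchwartzBruhat (ι₁ ⊕ ι₀ → F), MpPsi.toRep (schrodingerSB (dotProductBilin F F) ψ hl hb) q
      (MpPsi.toRep (schrodingerSB (dotProductBilin F F) ψ hl hb) q⁻¹ g) = g := fun g => by
    rw [← Module.End.mul_apply, ← map_mul, mul_inv_cancel, map_one, Module.End.one_apply]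
  rw [map_mul, map_mul, Module.End.mul_apply, Module.End.mul_apply, hM₀', hcp, map_smul, ← hM₀', hinv]

include hφ₀ in
/-- **CONJUGATION-QUOTIENTS ACT TRIVIALLY ON `S_Y`**: with `q` `Y`-stable and `p` acting by a non-zero scalar, `q p q⁻¹ p⁻¹` acts on `S_Y` trivially.
In U(2,1): `m(α) n(b, z) m(α)⁻¹ n(b, z)⁻¹ = n((α − 1) b, ·)` exhausts `N(ℓ)` modulo its centre (take `α` with `α`, `α − 1` units), and the centre is
commutators — so `N(ℓ)` acts trivially on `S_Y` (h₁), with no input on the splitting. [cite: MoeglinVignerasWaldspurger1987, Chap. 3 §IV.5]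
[cite: Kudla1986, proof of Thm. 2.8] [cite: GelbartRogawski1991, §3.2 (3.2.3) p. 457] -/
theorem fibreZero_toRep_conj_mul_inv (hψ : ψ.IsContinuousNontrivial) (q : MpPsi (schrodingerSB (dotProductBilin F F (m := ι₁ ⊕ ι₀)) ψ hl hb))
    (hq : ∀ y₁ : ι₁ → F, ∃ y₁' : ι₁ → F, (q.1.1).1 (0, Sum.elim y₁ 0) = (0, Sum.elim y₁' 0))
    (p : MpPsi (schrodingerSB (dotProductBilin F F (m := ι₁ ⊕ ι₀)) ψ hl hb)) {c : ℂ} (hc : c ≠ 0)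
    (hcp : ∀ f : SchwartzBruhat (ι₁ ⊕ ι₀ → F), φ₀ (MpPsi.toRep (schrodingerSB (dotProductBilin F F) ψ hl hb) p f) = c • φ₀ f)
    (f : SchwartzBruhat (ι₁ ⊕ ι₀ → F)) :
    φ₀ (MpPsi.toRep (schrodingerSB (dotProductBilin F F) ψ hl hb) (q * p * q⁻¹ * p⁻¹) f) = φ₀ f := by
  rw [map_mul, Module.End.mul_apply, fibreZero_toRep_conj_eq_smul hl hb φ₀ hφ₀ hψ q hq p hcp,
    fibreZero_toRep_inv_eq_smul hl hb φ₀ p hc hcp, smul_smul, mul_inv_cancel₀ hc, one_smul]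

/-- **products**: if `p`, `q` act on `S_Y` trivially then so does `p q` (closure of (h₁) under the group law; with
`fibreZero_toRep_inv_eq_smul` at `c = 1`, the `p ∈ S̃p_ψ` acting trivially on `S_Y` form a subgroup). [cite: MoeglinVignerasWaldspurger1987, Chap. 3 §IV.5] -/
theorem fibreZero_toRep_mul_eq (p q : MpPsi (schrodingerSB (dotProductBilin F F (m := ι₁ ⊕ ι₀)) ψ hl hb))
    (hp : ∀ f : SchwartzBruhat (ι₁ ⊕ ι₀ → F), φ₀ (MpPsi.toRep (schrodingerSB (dotProductBilin F F) ψ hl hb) p f) = φ₀ f)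
    (hq : ∀ f : SchwartzBruhat (ι₁ ⊕ ι₀ → F), φ₀ (MpPsi.toRep (schrodingerSB (dotProductBilin F F) ψ hl hb) q f) = φ₀ f)
    (f : SchwartzBruhat (ι₁ ⊕ ι₀ → F)) :
    φ₀ (MpPsi.toRep (schrodingerSB (dotProductBilin F F) ψ hl hb) (p * q) f) = φ₀ f := by
  rw [map_mul, Module.End.mul_apply, hp, hq]

/-- **inverses**: if `p` acts on `S_Y` trivially then so does `p⁻¹`. [cite: MoeglinVignerasWaldspurger1987, Chap. 3 §IV.5] -/
theorem fibreZero_toRep_inv_eq (p : MpPsi (schrodingerSB (dotProductBilin F F (m := ι₁ ⊕ ι₀)) ψ hl hb))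
    (hp : ∀ f : SchwartzBruhat (ι₁ ⊕ ι₀ → F), φ₀ (MpPsi.toRep (schrodingerSB (dotProductBilin F F) ψ hl hb) p f) = φ₀ f)
    (f : SchwartzBruhat (ι₁ ⊕ ι₀ → F)) :
    φ₀ (MpPsi.toRep (schrodingerSB (dotProductBilin F F) ψ hl hb) p⁻¹ f) = φ₀ f := by
  have h := fibreZero_toRep_inv_eq_smul hl hb φ₀ p one_ne_zero (fun g => by rw [hp, one_smul]) f
  rw [h, inv_one, one_smul]

end Scalars

/-! ## §5 Discharging (h₂) scalar-free: an implementer of `n(c)` trivial on `S_Y` IS `unipOpPi c` -/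

section ScalarFree

variable [Invertible (2 : F)] (c : (ι₁ ⊕ ι₀ → F) →ₗ[F] (ι₁ ⊕ ι₀ → F))

include hφ₀ in
/-- **THE CENTRE LANDS IN (h₂) ON THE NOSE**: let `c` be symmetric with chirp `1` on `X₀`, and `p = (n(c), M) ∈ S̃p_ψ` an implementer of the Siegel
unipotent `n(c)` that acts TRIVIALLY on `S_Y` (`φ₀ ∘ M = φ₀`, e.g. by §4).  Then `M = unipOpPi c` exactly: by uniqueness of implementers up to a
scalar (★ `implementerUniqueUpToScalar_schrodingerSB_pi`, ★ `unipotent_unipOpPi_mem_MpPsi`) `M = λ · unipOpPi c`; apply `φ₀` (§1) to a vector with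
`φ₀ f ≠ 0` (★ `fibreZero_surjective`, ★ `piBallSB_zero_ne_zero`) to get `λ = 1`.  So the scalar ambiguity of a splitting is invisible on `Z(N(ℓ))`.
[cite: MoeglinVignerasWaldspurger1987, Chap. 2 II.1 (A), II.6] [cite: Rangarao1993, Lemma 3.2 (1), p. 351] [cite: Kudla1986, proof of Thm. 2.8] -/
theorem toRep_eq_unipOpPi_of_fibreZero (hψ : ψ.IsContinuousNontrivial)
    (hc : ∀ x x' : ι₁ ⊕ ι₀ → F, dotProductBilin F F x (c x') = dotProductBilin F F x' (c x))
    (hc0 : ∀ x : ι₁ ⊕ ι₀ → F, x ∘ Sum.inl = 0 → halfForm c x = 0)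
    (p : MpPsi (schrodingerSB (dotProductBilin F F (m := ι₁ ⊕ ι₀)) ψ hl hb))
    (hp1 : p.1.1 = unipotentSp (dotProductBilin F F (m := ι₁ ⊕ ι₀)) c hc)
    (hp2 : ∀ f : SchwartzBruhat (ι₁ ⊕ ι₀ → F), φ₀ (MpPsi.toRep (schrodingerSB (dotProductBilin F F) ψ hl hb) p f) = φ₀ f)
    (f : SchwartzBruhat (ι₁ ⊕ ι₀ → F)) :
    MpPsi.toRep (schrodingerSB (dotProductBilin F F) ψ hl hb) p f = unipOpPi hl c f := by
  have hM : Implements (schrodingerSB (dotProductBilin F F) ψ hl hb)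
      (ofSymplectic _ (unipotentSp (dotProductBilin F F (m := ι₁ ⊕ ι₀)) c hc)) p.1.2 := by
    rw [← hp1]
    exact (mem_MpPsi _ _).1 p.2
  have hM' : Implements (schrodingerSB (dotProductBilin F F) ψ hl hb)
      (ofSymplectic _ (unipotentSp (dotProductBilin F F (m := ι₁ ⊕ ι₀)) c hc)) (unipOpPi hl c) :=
    (mem_MpPsi _ _).1 (unipotent_unipOpPi_mem_MpPsi hl hb c hc)
  obtain ⟨lam, hlam⟩ := implementerUniqueUpToScalar_schrodingerSB_pi hl hb hψ _ (unipOpPi hl c) p.1.2 hM' hM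
  -- `λ = 1`: test on a vector with non-zero fibre over `0`
  obtain ⟨f₁, hf₁⟩ := fibreZero_surjective φ₀ hφ₀ (piBallSB F ι₀ 0)
  have h1 : ((lam : ℂˣ) : ℂ) = 1 := by
    have h := hp2 f₁
    rw [MpPsi.toRep_apply, hlam, map_smul, fibreZero_unipOpPi hl φ₀ hφ₀ c hc0, hf₁] at h
    exact smul_left_injective ℂ (piBallSB_zero_ne_zero (F := F) (ι := ι₀)) (h.trans (one_smul ℂ _).symm)
  rw [MpPsi.toRep_apply, hlam, h1, one_smul]

include hφ₀ in
/-- **(h₂) from a homomorphism into `S̃p_ψ`**: if `s : N →* S̃p_ψ` (e.g. the transported splitting) sends a family `n_t` onto the Siegel unipotents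
`n(t c)` (`c` symmetric, chirp `1` on `X₀`; hypothesis on the underlying linear maps, `(x, y) ↦ (x, y + t c x)` = ★ `unipotentσ (t • c)`) and `N` acts
trivially on `S_Y` through `s`, then `toRep (s n_t) = unipOpPi (t c)` — hypothesis (h₂) of §3 for the representation `toRep ∘ s`. [cite: MoeglinVignerasWaldspurger1987, Chap. 2 II.1 (A), II.6; Chap. 3 §IV.5] [cite: Kudla1986, proof of Thm. 2.8] -/
theorem exists_toRep_comp_eq_unipOpPi (hψ : ψ.IsContinuousNontrivial)
    (hc : ∀ x x' : ι₁ ⊕ ι₀ → F, dotProductBilin F F x (c x') = dotProductBilin F F x' (c x))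
    (hc0 : ∀ x : ι₁ ⊕ ι₀ → F, x ∘ Sum.inl = 0 → halfForm c x = 0)
    {N : Type*} [Group N] (s : N →* MpPsi (schrodingerSB (dotProductBilin F F (m := ι₁ ⊕ ι₀)) ψ hl hb))
    (h₁ : ∀ (n : N) (f : SchwartzBruhat (ι₁ ⊕ ι₀ → F)), φ₀ (MpPsi.toRep (schrodingerSB (dotProductBilin F F) ψ hl hb) (s n) f) = φ₀ f)
    (hZ : ∀ t : F, ∃ n : N, ((s n).1.1).1 = unipotentσ (t • c))
    (t : F) :
    ∃ n : N, ∀ f : SchwartzBruhat (ι₁ ⊕ ι₀ → F),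
      ((MpPsi.toRep (schrodingerSB (dotProductBilin F F) ψ hl hb)).comp s) n f = unipOpPi hl (t • c) f := by
  obtain ⟨n, hn⟩ := hZ t
  refine ⟨n, fun f => ?_⟩
  rw [MonoidHom.coe_comp, Function.comp_apply]
  exact toRep_eq_unipOpPi_of_fibreZero hl hb φ₀ hφ₀ (t • c) hψ
    (fun x x' => by rw [LinearMap.smul_apply, LinearMap.smul_apply, map_smul, map_smul, hc])
    (fun x hx => by rw [halfForm_smul, hc0 x hx, mul_zero]) (s n) (Subtype.ext hn) (h₁ n) f

end ScalarFree

end Summit.HodgeConjecture.HodgeConjecture.Cruxes.H413.F0P2oHeisenbergYCoinvariantsJacquet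

end
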